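import Mathlib.ModelTheory.Definability
import Mathlib.ModelTheory.Order
import Literature.ModelTheory.ExponentialFields.ModelTheoryPreds
import HarnessLib

/-!
# Definability kit for one-variable o-minimal arguments

Topic `Literature/ModelTheory/ExponentialFields`.  The proofs of the monotonicity theorem and of
the finiteness lemma (van den Dries, *Tame topology and o-minimal structures* (1998), Ch. 3, §1)
apply o-minimality to a dozen auxiliary subsets of the line — the sets of points `x` satisfying
formulas such as `Φ₊₊(x)`, `Ψ₊₋(v)`, `x ∈ B`, `x ∈ X` there — each of which is "clearly
definable" because it is written in first-order terms from a definable function `f`, the order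
and parameters.  In Mathlib's semantic setting (`Set.Definable`, `Set.DefinableFun`) this
clarity has to be earned: this file packages the closure properties of definable sets of tuples
(`α → M`, parameters from all of `M`) in the shape those arguments need —

* atoms: `definable_setOf_rel` (a definable binary relation applied to two definable functions),
  `definable_setOf_lt` / `_le` / `_eq'` given that `<` is definable
  (hypothesis `hlt : univ.Definable L {v : Fin 2 → M | v 0 < v 1}`, which holds in every ordered
  structure: `definable_lt_of_orderedStructure`);
* functions: `definableFun_apply` — `v ↦ f (g v)` for a unary `f` with definable graph and a
  definable `g` (with `definableFun_proj` and `definableFun_const'` this covers all terms);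
* connectives: `definable_setOf_and` / `_or` / `_not` / `_imp`;
* quantifiers over `M`: `definable_setOf_forall` / `definable_setOf_exists` (the bound variable is
  adjoined as `α ⊕ Unit`, so nested quantifiers compose);
* the bridge to o-minimality: `isFiniteUnionOfIntervals_setOf` turns
  `univ.Definable L {v : Fin 1 → M | P (v 0)}` into `IsFiniteUnionOfIntervals {x | P x}` under
  `L.IsOMinimal M` (`ModelTheoryPreds.lean`).

All statements are folklore bookkeeping (van den Dries 1998, Ch. 1, (2.1)–(2.3) and (5.1)–(5.3):
first-order formulas define sets of the structure); nothing here is a named fact and nothing is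
specific to o-minimality except the last lemma.

## References

* [Dries1998] L. van den Dries, *Tame topology and o-minimal structures*, CUP 1998, Ch. 1, §2,
  §5.
-/

open Set FirstOrder FirstOrder.Language

namespace Literature.ModelTheory.ExponentialFields

universe u v

variable {L : Language.{u, v}} {M : Type*} [L.Structure M] {α : Type*}

/-! ### Functions -/

/-- Every constant function is definable with parameters from `univ` (Mathlib's
`definableFun_const` with the membership side condition discharged). [folklore] -/
theorem definableFun_const' (γ : Type*) (a : M) :
    (univ : Set M).DefinableFun L (fun _ : γ → M => a) :=
  Language.definableFun_const L γ (mem_univ a)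

/-- Coordinate projections `v ↦ v i` are definable functions of tuples (Mathlib's
`DefinableFun.proj`, with the language argument implicit). [folklore] -/
theorem definableFun_proj (i : α) : (univ : Set M).DefinableFun L (fun v : α → M => v i) :=
  Set.DefinableFun.proj L

/-- A unary function with definable graph, applied to a definable function of tuples, is a
definable function of tuples: `v ↦ f (g v)` (van den Dries 1998, Ch. 1, (2.3)(iii): compositions
of definable maps are definable). [cite: Dries1998, Ch. 1 (2.3)] -/
theorem definableFun_apply {f : M → M}
    (hf : (univ : Set M).Definable L {v : Fin 2 → M | v 1 = f (v 0)})
    {g : (α → M) → M} (hg : (univ : Set M).DefinableFun L g) :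
    (univ : Set M).DefinableFun L (fun v => f (g v)) := by
  -- `f` as a function of `1`-tuples
  have hf₁ : (univ : Set M).DefinableFun L (fun w : Fin 1 → M => f (w 0)) := by
    have h := hf.preimage_comp (![some 0, none] : Fin 2 → Option (Fin 1))
    have hEq : Function.tupleGraph (fun w : Fin 1 → M => f (w 0)) =
        ((fun g : Option (Fin 1) → M => g ∘ (![some 0, none] : Fin 2 → Option (Fin 1))) ⁻¹'
          {v : Fin 2 → M | v 1 = f (v 0)}) := by
      ext w
      simp only [Function.tupleGraph, mem_setOf_eq, mem_preimage, Function.comp_apply,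
        Matrix.cons_val_one, Matrix.cons_val_zero]
      exact eq_comm
    unfold Set.DefinableFun
    rw [hEq]
    exact h
  have hg₁ : (univ : Set M).DefinableMap L (fun v (_ : Fin 1) => g v) := fun _ => hg
  exact hf₁.comp hg₁

/-! ### Atoms -/

/-- A definable binary relation applied to two definable functions of tuples gives a definable
set of tuples: `{v | r (g v) (h v)}` (van den Dries 1998, Ch. 1, (2.3)(ii): inverse images of
definable sets under definable maps). [cite: Dries1998, Ch. 1 (2.3)] -/
theorem definable_setOf_rel {r : M → M → Prop}
    (hr : (univ : Set M).Definable L {v : Fin 2 → M | r (v 0) (v 1)})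
    {g h : (α → M) → M} (hg : (univ : Set M).DefinableFun L g)
    (hh : (univ : Set M).DefinableFun L h) :
    (univ : Set M).Definable L {v : α → M | r (g v) (h v)} := by
  have hF : (univ : Set M).DefinableMap L (fun v => (![g v, h v] : Fin 2 → M)) :=
    Fin.forall_fin_two.2 ⟨by simpa using hg, by simpa using hh⟩
  simpa using hr.preimage_map hF

/-- With `<` definable, `{v | g v < h v}` is definable for definable `g`, `h`
(van den Dries 1998, Ch. 1, (2.3)). [cite: Dries1998, Ch. 1 (2.3)] -/
theorem definable_setOf_lt [LT M]
    (hlt : (univ : Set M).Definable L {v : Fin 2 → M | v 0 < v 1})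
    {g h : (α → M) → M} (hg : (univ : Set M).DefinableFun L g)
    (hh : (univ : Set M).DefinableFun L h) :
    (univ : Set M).Definable L {v : α → M | g v < h v} :=
  definable_setOf_rel hlt hg hh

/-- With `<` definable on a linear order, `{v | g v ≤ h v}` is definable (complement of
`h v < g v`). [cite: Dries1998, Ch. 1 (2.3)] -/
theorem definable_setOf_le [LinearOrder M]
    (hlt : (univ : Set M).Definable L {v : Fin 2 → M | v 0 < v 1})
    {g h : (α → M) → M} (hg : (univ : Set M).DefinableFun L g)
    (hh : (univ : Set M).DefinableFun L h) :
    (univ : Set M).Definable L {v : α → M | g v ≤ h v} := by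
  have h' := (definable_setOf_lt hlt hh hg).compl
  refine (congrArg _ ?_).mpr h'
  ext v
  simp

/-- `{v | g v = h v}` is definable for definable `g`, `h` (Mathlib's `DefinableFun.setOf_eq`,
restated in the kit's argument order). [folklore] -/
theorem definable_setOf_eq' {g h : (α → M) → M} (hg : (univ : Set M).DefinableFun L g)
    (hh : (univ : Set M).DefinableFun L h) :
    (univ : Set M).Definable L {v : α → M | g v = h v} :=
  hg.setOf_eq hh

/-! ### Connectives -/

omit [L.Structure M] in
/-- Conjunction of definable conditions is definable. [folklore] -/
theorem definable_setOf_and [L.Structure M] {P Q : (α → M) → Prop}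
    (hP : (univ : Set M).Definable L {v | P v}) (hQ : (univ : Set M).Definable L {v | Q v}) :
    (univ : Set M).Definable L {v | P v ∧ Q v} :=
  hP.inter hQ

omit [L.Structure M] in
/-- Disjunction of definable conditions is definable. [folklore] -/
theorem definable_setOf_or [L.Structure M] {P Q : (α → M) → Prop}
    (hP : (univ : Set M).Definable L {v | P v}) (hQ : (univ : Set M).Definable L {v | Q v}) :
    (univ : Set M).Definable L {v | P v ∨ Q v} :=
  hP.union hQ

omit [L.Structure M] in
/-- Negation of a definable condition is definable. [folklore] -/
theorem definable_setOf_not [L.Structure M] {P : (α → M) → Prop}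
    (hP : (univ : Set M).Definable L {v | P v}) :
    (univ : Set M).Definable L {v | ¬ P v} :=
  hP.compl

omit [L.Structure M] in
/-- Implication between definable conditions is definable. [folklore] -/
theorem definable_setOf_imp [L.Structure M] {P Q : (α → M) → Prop}
    (hP : (univ : Set M).Definable L {v | P v}) (hQ : (univ : Set M).Definable L {v | Q v}) :
    (univ : Set M).Definable L {v | P v → Q v} := by
  have h := hP.compl.union hQ
  refine (congrArg _ ?_).mpr h
  ext v
  simp only [mem_setOf_eq, mem_union, mem_compl_iff]
  exact imp_iff_not_or

/-! ### Quantifiers over `M` -/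

omit [L.Structure M] in
/-- Universal quantification over `M` of a definable condition is definable; the bound variable
is the `Unit` summand of `α ⊕ Unit` (Mathlib's `Definable.forall_of_finite`, reshaped).
[folklore] -/
theorem definable_setOf_forall [L.Structure M] {P : (α → M) → M → Prop}
    (h : (univ : Set M).Definable L
      {w : α ⊕ Unit → M | P (fun i => w (Sum.inl i)) (w (Sum.inr ()))}) :
    (univ : Set M).Definable L {v : α → M | ∀ y, P v y} := by
  have h' := h.forall_of_finite
  refine (congrArg _ ?_).mpr h'
  ext v
  simp only [mem_setOf_eq, Sum.elim_inl, Sum.elim_inr]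
  exact ⟨fun hv u => hv (u ()), fun hv y => hv fun _ => y⟩

omit [L.Structure M] in
/-- Existential quantification over `M` of a definable condition is definable; the bound
variable is the `Unit` summand of `α ⊕ Unit` (Mathlib's `Definable.exists_of_finite`, reshaped).
[folklore] -/
theorem definable_setOf_exists [L.Structure M] {P : (α → M) → M → Prop}
    (h : (univ : Set M).Definable L
      {w : α ⊕ Unit → M | P (fun i => w (Sum.inl i)) (w (Sum.inr ()))}) :
    (univ : Set M).Definable L {v : α → M | ∃ y, P v y} := by
  have h' := h.exists_of_finite
  refine (congrArg _ ?_).mpr h'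
  ext v
  simp only [mem_setOf_eq, Sum.elim_inl, Sum.elim_inr]
  exact ⟨fun ⟨y, hy⟩ => ⟨fun _ => y, hy⟩, fun ⟨u, hu⟩ => ⟨u (), hu⟩⟩

/-! ### The order is definable in an ordered structure -/

/-- In an ordered structure (Mathlib's `L.OrderedStructure M`: the symbol `≤` of `L` is
interpreted as `≤`), the strict order `{v | v 0 < v 1}` is definable without parameters, hence
with parameters (van den Dries 1998, Ch. 1, (3.2), axiom (O1)). [cite: Dries1998, Ch. 1 (3.2)] -/
theorem definable_lt_of_orderedStructure [L.IsOrdered] [Preorder M] [L.OrderedStructure M] :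
    (univ : Set M).Definable L {v : Fin 2 → M | v 0 < v 1} := by
  refine Set.Definable.mono ?_ (empty_subset _)
  refine (Set.empty_definable_iff).2
    ⟨(Term.var (Sum.inl 0)).lt (Term.var (Sum.inl 1)), ?_⟩
  ext v
  simp only [mem_setOf_eq, Formula.Realize, Term.realize_lt, Term.realize_var, Sum.elim_inl]

/-! ### Bridge to o-minimality -/

/-- In an o-minimal structure, the set of points satisfying a definable condition is a finite
union of points and intervals (van den Dries 1998, Ch. 1, (3.2), (O2); Pillay–Steinhorn 1986,
Def. 1.1) — the unfolding of `L.IsOMinimal M` for sets written as `{x | P x}`.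
[cite: Dries1998, Ch. 1 (3.2)] -/
theorem isFiniteUnionOfIntervals_setOf [LinearOrder M] (hO : L.IsOMinimal M) {P : M → Prop}
    (h : (univ : Set M).Definable L {v : Fin 1 → M | P (v 0)}) :
    IsFiniteUnionOfIntervals {x | P x} :=
  hO _ h

end Literature.ModelTheory.ExponentialFields
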